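import Summits.CriticalPhenomena.PercolationContinuityZ3.Theses.PercExchangeRateTransport
import Summits.CriticalPhenomena.PercolationContinuityZ3.Theorems.PercExchangeRateTransportSubcritExchangeUniformityStubSlopePositiveOnCurve
import HarnessLib

/-!
# Regime split of the crux `SupercritExchangeUniformity` (K⁺), line `local_exchange_homogeneity`
# (stmt-CriticalPhenomena-16061): `OffWindowLimit → LimitFieldRegular → WindowFlatness → K⁺` and
# the converse `K⁺ → OffWindowLimit ∧ LimitFieldRegular ∧ WindowFlatness`

Def-free landing of the strategist's split file
`Cruxes/SupercritExchangeUniformity/Lines/regime_split_glue.lean` (kernel-checked there over named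
objects `boxArm, pcA, dT, dP, rateLim`), with the fourth piece `RussoPositivity` no longer a
hypothesis: it is DISCHARGED (landed per sub-arc as
`Theorems.SupercritExchangeUniformity.RussoPositivity`, p172277; re-proved here in the uniform
form its proof gives, `Split.deriv_p_pos_collar` — one collar width for all `t ∈ (0,1)` — from the
landed K⁻ theorems `exists_density_thetaPerc_pos`, `pc_mem_Ioo`, `thetaBox_deriv_p_pos`, so that
this file does not wait for the olean of p172277).  The three remaining pieces are the registered
stubs of the item, written VERBATIM (route `let` preamble `μ, vert, cfg, Θ, θ, pc`, and
`aInf := limUnder_n ∂_tΘ_n/∂_pΘ_n`) as hypotheses of `SupercritExchangeUniformity_of_subs` and as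
conjuncts of the conclusion of `subs_of_SupercritExchangeUniformity`; the conclusion, resp.
hypothesis, is the route declaration `PercExchangeRateTransport.SupercritExchangeUniformity` BY
NAME.  (`OffWindowLimit`: convergence of `a_n = ∂_tΘ_n/∂_pΘ_n` to `a_∞` off every `ε`-window of
a `ρ`-collar; `LimitFieldRegular`: a field `a`, continuous on the closed collar, `L`-Lipschitz in
`p`, `= a_∞` strictly above the curve; `WindowFlatness`: asymptotic `η`-flatness of `a_n` across
`[p_c(t), p_c(t)+ε]`.)

Layout.  Namespace `…SupercritExchangeUniformity.Split`: the positivity collar, then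
percolation-free real algebra over abstract families `N D : ℕ → ℝ → ℝ → ℝ` (here `∂_tΘ_n`,
`∂_pΘ_n`) and an abstract curve `pc`: `seam` (three-ε argument through the window),
`limUnder_ratio_eq` (pointwise limit identification), `crux_of_pieces` (the four abstract pieces
on one sub-arc ⇒ the K⁺ clause there, `ρ := min ρ₁ ρ₂`), `pieces_of_crux` (converse,
`ρ := min ρ ε₀`).  The two anchor theorems only instantiate `N D pc` with the route's `let`s (the
`let`-literals of the pieces and of the crux are syntactically identical, so hypotheses apply by
unification) and restrict the positivity collar to the sub-arc.  Their headers are one long line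
each: the gate matches registered stub signatures against the verbatim header text.

References: Aizenman–Grimmett, J. Stat. Phys. 63 (1991); Chayes–Schonmann, Ann. Appl. Probab. 10
(2000) Thm 1.4; Grimmett, Percolation (1999) §2.4.
-/

noncomputable section

open MeasureTheory Filter Topology
open Literature.Probability.Percolation Literature.Probability.LatticeModels
open Summit.CriticalPhenomena.PercolationContinuityZ3.Theorems.SubcritExchangeUniformity
  (exists_density_thetaPerc_pos pc_mem_Ioo thetaBox_deriv_p_pos)

namespace Summit.CriticalPhenomena.PercolationContinuityZ3.Theorems.SupercritExchangeUniformity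

namespace Split

/-- **A uniform Russo-positivity collar above the critical curve** (the positivity piece of the
split, ONE collar width for all `t ∈ (0,1)`; per sub-arc = the landed `RussoPositivity`, p172277,
same proof).  There is `ε > 0` — namely `(1 - q₀)/2` for the density `q₀ < 1` of
`exists_density_thetaPerc_pos`, which bounds `p_c(t) ≤ q₀` by `csInf_le` — such that for all
`n ≥ 1`, `t ∈ (0,1)` and `p_c(t) ≤ p ≤ p_c(t) + ε`: `0 < ∂_pΘ_n(p,t)`, because `0 < p_c(t)`
(`pc_mem_Ioo`) puts `(p,t)` in the open square, where Russo positivity `thetaBox_deriv_p_pos`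
applies (one-line header: route `let` preamble). [Grimmett1999 §2.4 Thm. (2.25); Russo1981 §4] -/
theorem deriv_p_pos_collar : let μ := Literature.Probability.Percolation.labelMeasure (Literature.Probability.LatticeModels.Site 3); let vert : Sym2 (Literature.Probability.LatticeModels.Site 3) → Prop := fun e => ∃ x : Literature.Probability.LatticeModels.Site 3, e = s(x, x + Pi.single (2 : Fin 3) 1); let cfg : ℝ → ℝ → (Sym2 (Literature.Probability.LatticeModels.Site 3) → ℝ) → Set (Sym2 (Literature.Probability.LatticeModels.Site 3)) := fun p t U => {e | e ∈ (Literature.Probability.LatticeModels.zdGraph 3).edgeSet ∧ ((vert e ∧ U e ≤ t) ∨ (¬ vert e ∧ U e ≤ p))}; let Θ : ℕ → ℝ → ℝ → ℝ := fun n p t => μ.real {U | cfg p t U ∈ Literature.Probability.Percolation.siteToBoundary 3 n}; let θ : ℝ → ℝ → ℝ := fun p t => μ.real {U | cfg p t U ∈ Literature.Probability.Percolation.percolatesAt (0 : Literature.Probability.LatticeModels.Site 3)}; let pc : ℝ → ℝ := fun t => sInf ({p : ℝ | 0 ≤ p ∧ p ≤ 1 ∧ 0 < θ p t} ∪ {1});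 ∃ ε > (0 : ℝ), ∀ n : ℕ, 1 ≤ n → ∀ t ∈ Set.Ioo (0 : ℝ) 1, ∀ p : ℝ, pc t ≤ p → p ≤ pc t + ε → 0 < deriv (fun q => Θ n q t) p := by
  intro μ vert cfg Θ θ pc
  obtain ⟨q₀, hq₀, hq₁, hθq⟩ := exists_density_thetaPerc_pos
  have hpc_le : ∀ t, pc t ≤ q₀ := fun t => by
    refine csInf_le ⟨0, ?_⟩ (Or.inl ⟨hq₀, hq₁.le, hθq t⟩)
    rintro p (⟨hp, -⟩ | hp)
    · exact hp
    · rw [Set.mem_singleton_iff] at hp; rw [hp]; exact zero_le_one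
  have h8 := thetaBox_deriv_p_pos
  refine ⟨(1 - q₀) / 2, by linarith, ?_⟩
  intro n hn t ht p hp1 hp2
  have h0 : 0 < pc t := (pc_mem_Ioo t ht).1
  have h1 := hpc_le t
  have hp : p ∈ Set.Ioo (0 : ℝ) 1 := ⟨h0.trans_le hp1, by linarith⟩
  exact h8 n hn p hp t ht

/-- **Seam lemma** (percolation-free real algebra).  For arbitrary families
`N D : ℕ → ℝ → ℝ → ℝ` (here `∂_tΘ_n`, `∂_pΘ_n`) and an arbitrary curve `pc`: a field `a`,
`L`-Lipschitz in `p` on the `ρ`-collar, that controls `N − a D` off every `ε`-window, together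
with asymptotic `η`-flatness of `N/D` across small windows and positivity of `D` on an
`ε₀`-window for `n ≥ m₀`, controls `N − a D` on the whole closed collar: for
`p` in the window compare with `p' = pc t + ε'`, `ε' = min (min ε ε₀) (min ρ (η/(3(|L|+1))))`,
through `N/D(p) ≈ N/D(p') ≈ a(p') ≈ a(p)`. [folklore] -/
theorem seam {N D : ℕ → ℝ → ℝ → ℝ} {pc : ℝ → ℝ} {a : ℝ → ℝ → ℝ} {lo hi ρ L ε₀ : ℝ} {m₀ : ℕ}
    (hρ : 0 < ρ) (hε₀ : 0 < ε₀)
    (hlip : ∀ t ∈ Set.Icc lo hi, ∀ p q : ℝ, pc t ≤ p → p ≤ pc t + ρ → pc t ≤ q → q ≤ pc t + ρ →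
      |a p t - a q t| ≤ L * |p - q|)
    (hoff : ∀ ε > (0 : ℝ), ∀ η > (0 : ℝ), ∃ m : ℕ, ∀ n ≥ m, ∀ t ∈ Set.Icc lo hi, ∀ p : ℝ,
      pc t + ε ≤ p → p ≤ pc t + ρ → |N n p t - a p t * D n p t| ≤ η * D n p t)
    (hwin : ∀ η > (0 : ℝ), ∃ ε > (0 : ℝ), ∃ m : ℕ, ∀ n ≥ m, ∀ t ∈ Set.Icc lo hi, ∀ p p' : ℝ,
      pc t ≤ p → p ≤ pc t + ε → pc t ≤ p' → p' ≤ pc t + ε →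
        |N n p t / D n p t - N n p' t / D n p' t| ≤ η)
    (hpos : ∀ n ≥ m₀, ∀ t ∈ Set.Icc lo hi, ∀ p : ℝ, pc t ≤ p → p ≤ pc t + ε₀ → 0 < D n p t) :
    ∀ η > (0 : ℝ), ∃ m : ℕ, ∀ n ≥ m, ∀ t ∈ Set.Icc lo hi, ∀ p : ℝ, pc t ≤ p → p ≤ pc t + ρ →
      |N n p t - a p t * D n p t| ≤ η * D n p t := by
  intro η hη
  have hη3 : 0 < η / 3 := by positivity
  obtain ⟨ε, hε, m₁, hflat⟩ := hwin (η / 3) hη3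
  have hL1 : 0 < |L| + 1 := by positivity
  set ε' : ℝ := min (min ε ε₀) (min ρ (η / (3 * (|L| + 1)))) with hε'def
  have hε'pos : 0 < ε' := lt_min (lt_min hε hε₀) (lt_min hρ (by positivity))
  have hε'ε : ε' ≤ ε := (min_le_left _ _).trans (min_le_left _ _)
  have hε'ε₀ : ε' ≤ ε₀ := (min_le_left _ _).trans (min_le_right _ _)
  have hε'ρ : ε' ≤ ρ := (min_le_right _ _).trans (min_le_left _ _)
  have hε'L : ε' ≤ η / (3 * (|L| + 1)) := (min_le_right _ _).trans (min_le_right _ _)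
  obtain ⟨m₂, hoff₂⟩ := hoff ε' hε'pos η hη
  obtain ⟨m₃, hoff₃⟩ := hoff ε' hε'pos (η / 3) hη3
  refine ⟨max m₀ (max m₁ (max m₂ m₃)), fun n hn t ht p hp1 hp2 => ?_⟩
  simp only [ge_iff_le, max_le_iff] at hn
  obtain ⟨hn₀, hn₁, hn₂, hn₃⟩ := hn
  rcases le_or_gt (pc t + ε') p with hcase | hcase
  · exact hoff₂ n hn₂ t ht p hcase hp2
  · set p' : ℝ := pc t + ε' with hp'def
    have hq1 : pc t ≤ p' := by rw [hp'def]; linarith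
    have hq2 : p' ≤ pc t + ε := by rw [hp'def]; linarith
    have hq3 : p' ≤ pc t + ρ := by rw [hp'def]; linarith
    have hq4 : p' ≤ pc t + ε₀ := by rw [hp'def]; linarith
    have hpε : p ≤ pc t + ε := by linarith
    have hpε₀ : p ≤ pc t + ε₀ := by linarith
    have hdiff := hflat n hn₁ t ht p p' hp1 hpε hq1 hq2
    have hDp : 0 < D n p t := hpos n hn₀ t ht p hp1 hpε₀
    have hDq : 0 < D n p' t := hpos n hn₀ t ht p' hq1 hq4
    have h1 := hoff₃ n hn₃ t ht p' (le_of_eq hp'def.symm) hq3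
    have hr1 : |N n p' t / D n p' t - a p' t| ≤ η / 3 := by
      have e : N n p' t / D n p' t - a p' t = (N n p' t - a p' t * D n p' t) / D n p' t := by
        field_simp
      rw [e, abs_div, abs_of_pos hDq, div_le_iff₀ hDq]
      exact h1
    have hl := hlip t ht p' p hq1 hq3 hp1 (by linarith)
    have hpp' : |p' - p| ≤ ε' := by
      rw [abs_of_nonneg (by linarith)]
      linarith
    have hl' : |a p' t - a p t| ≤ η / 3 :=
      calc |a p' t - a p t| ≤ L * |p' - p| := hl
        _ ≤ |L| * |p' - p| := mul_le_mul_of_nonneg_right (le_abs_self L) (abs_nonneg _)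
        _ ≤ |L| * ε' := mul_le_mul_of_nonneg_left hpp' (abs_nonneg L)
        _ ≤ |L| * (η / (3 * (|L| + 1))) := mul_le_mul_of_nonneg_left hε'L (abs_nonneg L)
        _ ≤ η / 3 := by
          rw [← sub_nonneg]
          have e : η / 3 - |L| * (η / (3 * (|L| + 1))) = (η / 3) * (1 / (|L| + 1)) := by
            field_simp
            ring
          rw [e]
          positivity
    have hsum : |N n p t / D n p t - a p t| ≤ η := by
      calc |N n p t / D n p t - a p t|
          ≤ |N n p t / D n p t - N n p' t / D n p' t| + |N n p' t / D n p' t - a p' t| +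
              |a p' t - a p t| := by
            have := abs_sub_le (N n p t / D n p t) (N n p' t / D n p' t) (a p t)
            have := abs_sub_le (N n p' t / D n p' t) (a p' t) (a p t)
            linarith
        _ ≤ η / 3 + η / 3 + η / 3 := by gcongr
        _ = η := by ring
    have e : N n p t - a p t * D n p t = (N n p t / D n p t - a p t) * D n p t := by
      field_simp
    rw [e, abs_mul, abs_of_pos hDp]
    exact mul_le_mul_of_nonneg_right hsum hDp.le

/-- **Pointwise limit identification.** If `|N_n − a D_n| ≤ η D_n` eventually for every `η > 0`
and `D_n > 0` for `n ≥ m₀`, then `N_n / D_n → a`, hence `limUnder atTop (N/D) = a`. [folklore] -/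
theorem limUnder_ratio_eq {N D : ℕ → ℝ} {a : ℝ} {m₀ : ℕ}
    (hconv : ∀ η > (0 : ℝ), ∃ m : ℕ, ∀ n ≥ m, |N n - a * D n| ≤ η * D n)
    (hpos : ∀ n ≥ m₀, 0 < D n) :
    Tendsto (fun n => N n / D n) atTop (𝓝 a) ∧ limUnder atTop (fun n => N n / D n) = a := by
  have ht : Tendsto (fun n => N n / D n) atTop (𝓝 a) := by
    rw [Metric.tendsto_atTop]
    intro η hη
    obtain ⟨m, hm⟩ := hconv (η / 2) (by positivity)
    refine ⟨max m₀ m, fun n hn => ?_⟩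
    have hn₀ : m₀ ≤ n := le_trans (le_max_left _ _) hn
    have hn₁ : m ≤ n := le_trans (le_max_right _ _) hn
    have hD : 0 < D n := hpos n hn₀
    have h := hm n hn₁
    rw [Real.dist_eq]
    have e : N n / D n - a = (N n - a * D n) / D n := by field_simp
    rw [e, abs_div, abs_of_pos hD, div_lt_iff₀ hD]
    calc |N n - a * D n| ≤ η / 2 * D n := h
      _ < η * D n := by nlinarith
  exact ⟨ht, ht.limUnder_eq⟩

/-! ## The composition and its converse on ONE sub-arc, over abstract `N D pc` -/

/-- **The K⁺ clause on one sub-arc from the four abstract pieces on that sub-arc.**  Take `ρ₁` from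
the off-window piece, `ρ₂, L, a` from the regularity piece, `ε₀` from positivity, and set
`ρ = min ρ₁ ρ₂`; `a` is continuous and `p`-Lipschitz on the `ρ`-collar (restriction) and equals
`aInf` strictly above the curve, so the off-window piece gives `|N − a D| ≤ η D` off every
`ε`-window; the seam fed with flatness and positivity extends this to the whole closed collar.
[folklore] -/
theorem crux_of_pieces {N D : ℕ → ℝ → ℝ → ℝ} {pc : ℝ → ℝ} {aInf : ℝ → ℝ → ℝ} {lo hi : ℝ}
    (hO : ∃ ρ > (0 : ℝ), ∀ ε > (0 : ℝ), ∀ η > (0 : ℝ), ∃ m : ℕ, ∀ n ≥ m, ∀ t ∈ Set.Icc lo hi,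
      ∀ p : ℝ, pc t + ε ≤ p → p ≤ pc t + ρ → |N n p t - aInf p t * D n p t| ≤ η * D n p t)
    (hR : ∃ ρ > (0 : ℝ), ∃ L : ℝ, ∃ a : ℝ → ℝ → ℝ,
      ContinuousOn (fun x : ℝ × ℝ => a x.1 x.2)
          {x : ℝ × ℝ | x.2 ∈ Set.Icc lo hi ∧ pc x.2 ≤ x.1 ∧ x.1 ≤ pc x.2 + ρ} ∧
        (∀ t ∈ Set.Icc lo hi, ∀ p q : ℝ, pc t ≤ p → p ≤ pc t + ρ → pc t ≤ q → q ≤ pc t + ρ →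
          |a p t - a q t| ≤ L * |p - q|) ∧
        ∀ t ∈ Set.Icc lo hi, ∀ p : ℝ, pc t < p → p ≤ pc t + ρ → a p t = aInf p t)
    (hW : ∀ η > (0 : ℝ), ∃ ε > (0 : ℝ), ∃ m : ℕ, ∀ n ≥ m, ∀ t ∈ Set.Icc lo hi, ∀ p p' : ℝ,
      pc t ≤ p → p ≤ pc t + ε → pc t ≤ p' → p' ≤ pc t + ε →
        |N n p t / D n p t - N n p' t / D n p' t| ≤ η)
    (hP : ∃ ε > (0 : ℝ), ∀ n : ℕ, 1 ≤ n → ∀ t ∈ Set.Icc lo hi, ∀ p : ℝ, pc t ≤ p →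
      p ≤ pc t + ε → 0 < D n p t) :
    ∃ ρ > (0 : ℝ), ∃ L : ℝ, ∃ a : ℝ → ℝ → ℝ,
      ContinuousOn (fun x : ℝ × ℝ => a x.1 x.2)
          {x : ℝ × ℝ | x.2 ∈ Set.Icc lo hi ∧ pc x.2 ≤ x.1 ∧ x.1 ≤ pc x.2 + ρ} ∧
        (∀ t ∈ Set.Icc lo hi, ∀ p q : ℝ, pc t ≤ p → p ≤ pc t + ρ → pc t ≤ q → q ≤ pc t + ρ →
          |a p t - a q t| ≤ L * |p - q|) ∧
        ∀ η > (0 : ℝ), ∃ m : ℕ, ∀ n ≥ m, ∀ t ∈ Set.Icc lo hi, ∀ p : ℝ, pc t ≤ p → p ≤ pc t + ρ →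
          |N n p t - a p t * D n p t| ≤ η * D n p t := by
  obtain ⟨ρ₁, hρ₁, hconv⟩ := hO
  obtain ⟨ρ₂, hρ₂, L, a, hcont, hlip, hagree⟩ := hR
  obtain ⟨ε₀, hε₀, hpos⟩ := hP
  set ρ : ℝ := min ρ₁ ρ₂ with hρdef
  have hρ : 0 < ρ := lt_min hρ₁ hρ₂
  have hρle₁ : ρ ≤ ρ₁ := min_le_left _ _
  have hρle₂ : ρ ≤ ρ₂ := min_le_right _ _
  have hcont' : ContinuousOn (fun x : ℝ × ℝ => a x.1 x.2)
      {x : ℝ × ℝ | x.2 ∈ Set.Icc lo hi ∧ pc x.2 ≤ x.1 ∧ x.1 ≤ pc x.2 + ρ} :=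
    hcont.mono fun x ⟨hx1, hx2, hx3⟩ => ⟨hx1, hx2, hx3.trans (by linarith)⟩
  have hlip' : ∀ t ∈ Set.Icc lo hi, ∀ p q : ℝ, pc t ≤ p → p ≤ pc t + ρ → pc t ≤ q →
      q ≤ pc t + ρ → |a p t - a q t| ≤ L * |p - q| :=
    fun t ht p q hp1 hp2 hq1 hq2 => hlip t ht p q hp1 (by linarith) hq1 (by linarith)
  have hoff : ∀ ε > (0 : ℝ), ∀ η > (0 : ℝ), ∃ m : ℕ, ∀ n ≥ m, ∀ t ∈ Set.Icc lo hi, ∀ p : ℝ,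
      pc t + ε ≤ p → p ≤ pc t + ρ → |N n p t - a p t * D n p t| ≤ η * D n p t := by
    intro ε hε η hη
    obtain ⟨m, hm⟩ := hconv ε hε η hη
    refine ⟨m, fun n hn t ht p hp1 hp2 => ?_⟩
    rw [hagree t ht p (by linarith) (by linarith)]
    exact hm n hn t ht p hp1 (by linarith)
  exact ⟨ρ, hρ, L, a, hcont', hlip', seam hρ hε₀ hlip' hoff hW hpos⟩

/-- **The three abstract pieces on one sub-arc from the K⁺ clause and positivity on that sub-arc**
(the split is lossless modulo positivity).  Given K⁺'s `ρ, L, a` and the positivity window `ε₀`, on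
the collar of radius `min ρ ε₀` the ratio `N_n/D_n → a` pointwise, so `a = limUnder (N/D)` there:
this is the regularity piece, turns K⁺ into the off-window piece, and gives flatness with
`ε = min (min ρ ε₀) (η/(3(|L|+1)))` through `N_n/D_n(p) ≈ a(p) ≈ a(p') ≈ N_n/D_n(p')`. [folklore] -/
theorem pieces_of_crux {N D : ℕ → ℝ → ℝ → ℝ} {pc : ℝ → ℝ} {lo hi : ℝ}
    (hK : ∃ ρ > (0 : ℝ), ∃ L : ℝ, ∃ a : ℝ → ℝ → ℝ,
      ContinuousOn (fun x : ℝ × ℝ => a x.1 x.2)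
          {x : ℝ × ℝ | x.2 ∈ Set.Icc lo hi ∧ pc x.2 ≤ x.1 ∧ x.1 ≤ pc x.2 + ρ} ∧
        (∀ t ∈ Set.Icc lo hi, ∀ p q : ℝ, pc t ≤ p → p ≤ pc t + ρ → pc t ≤ q → q ≤ pc t + ρ →
          |a p t - a q t| ≤ L * |p - q|) ∧
        ∀ η > (0 : ℝ), ∃ m : ℕ, ∀ n ≥ m, ∀ t ∈ Set.Icc lo hi, ∀ p : ℝ, pc t ≤ p → p ≤ pc t + ρ →
          |N n p t - a p t * D n p t| ≤ η * D n p t)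
    (hP : ∃ ε > (0 : ℝ), ∀ n : ℕ, 1 ≤ n → ∀ t ∈ Set.Icc lo hi, ∀ p : ℝ, pc t ≤ p →
      p ≤ pc t + ε → 0 < D n p t) :
    (∃ ρ > (0 : ℝ), ∀ ε > (0 : ℝ), ∀ η > (0 : ℝ), ∃ m : ℕ, ∀ n ≥ m, ∀ t ∈ Set.Icc lo hi, ∀ p : ℝ,
      pc t + ε ≤ p → p ≤ pc t + ρ →
        |N n p t - limUnder atTop (fun k : ℕ => N k p t / D k p t) * D n p t| ≤ η * D n p t) ∧
    (∃ ρ > (0 : ℝ), ∃ L : ℝ, ∃ a : ℝ → ℝ → ℝ,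
      ContinuousOn (fun x : ℝ × ℝ => a x.1 x.2)
          {x : ℝ × ℝ | x.2 ∈ Set.Icc lo hi ∧ pc x.2 ≤ x.1 ∧ x.1 ≤ pc x.2 + ρ} ∧
        (∀ t ∈ Set.Icc lo hi, ∀ p q : ℝ, pc t ≤ p → p ≤ pc t + ρ → pc t ≤ q → q ≤ pc t + ρ →
          |a p t - a q t| ≤ L * |p - q|) ∧
        ∀ t ∈ Set.Icc lo hi, ∀ p : ℝ, pc t < p → p ≤ pc t + ρ →
          a p t = limUnder atTop (fun k : ℕ => N k p t / D k p t)) ∧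
    (∀ η > (0 : ℝ), ∃ ε > (0 : ℝ), ∃ m : ℕ, ∀ n ≥ m, ∀ t ∈ Set.Icc lo hi, ∀ p p' : ℝ,
      pc t ≤ p → p ≤ pc t + ε → pc t ≤ p' → p' ≤ pc t + ε →
        |N n p t / D n p t - N n p' t / D n p' t| ≤ η) := by
  obtain ⟨ρ₀, hρ₀, L, a, hcont, hlip, hconv⟩ := hK
  obtain ⟨ε₀, hε₀, hpos⟩ := hP
  set ρ : ℝ := min ρ₀ ε₀ with hρdef
  have hρ : 0 < ρ := lt_min hρ₀ hε₀
  have h₁ : ρ ≤ ρ₀ := min_le_left _ _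
  have h₂ : ρ ≤ ε₀ := min_le_right _ _
  -- K⁺'s data and the positivity window, restricted to the `ρ`-collar
  have hcont' : ContinuousOn (fun x : ℝ × ℝ => a x.1 x.2)
      {x : ℝ × ℝ | x.2 ∈ Set.Icc lo hi ∧ pc x.2 ≤ x.1 ∧ x.1 ≤ pc x.2 + ρ} :=
    hcont.mono fun x ⟨hx1, hx2, hx3⟩ => ⟨hx1, hx2, hx3.trans (by linarith)⟩
  have hlip' : ∀ t ∈ Set.Icc lo hi, ∀ p q : ℝ, pc t ≤ p → p ≤ pc t + ρ → pc t ≤ q →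
      q ≤ pc t + ρ → |a p t - a q t| ≤ L * |p - q| :=
    fun t ht p q hp1 hp2 hq1 hq2 => hlip t ht p q hp1 (by linarith) hq1 (by linarith)
  have hconv' : ∀ η > (0 : ℝ), ∃ m : ℕ, ∀ n ≥ m, ∀ t ∈ Set.Icc lo hi, ∀ p : ℝ, pc t ≤ p →
      p ≤ pc t + ρ → |N n p t - a p t * D n p t| ≤ η * D n p t := by
    intro η hη
    obtain ⟨m, hm⟩ := hconv η hη
    exact ⟨m, fun n hn t ht p hp1 hp2 => hm n hn t ht p hp1 (by linarith)⟩
  have hpos' : ∀ n ≥ 1, ∀ t ∈ Set.Icc lo hi, ∀ p : ℝ, pc t ≤ p → p ≤ pc t + ρ →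
      0 < D n p t :=
    fun n hn t ht p hp1 hp2 => hpos n hn t ht p hp1 (by linarith)
  -- `a = limUnder (N/D)` on the closed `ρ`-collar
  have hagree : ∀ t ∈ Set.Icc lo hi, ∀ p : ℝ, pc t ≤ p → p ≤ pc t + ρ →
      a p t = limUnder atTop (fun k : ℕ => N k p t / D k p t) := by
    intro t ht p hp1 hp2
    have h := limUnder_ratio_eq (N := fun k => N k p t) (D := fun k => D k p t) (a := a p t)
      (m₀ := 1)
      (fun η hη => by
        obtain ⟨m, hm⟩ := hconv' η hη
        exact ⟨m, fun n hn => hm n hn t ht p hp1 hp2⟩)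
      (fun n hn => hpos' n hn t ht p hp1 hp2)
    exact h.2.symm
  refine ⟨?_, ⟨ρ, hρ, L, a, hcont', hlip', fun t ht p hp1 hp2 => hagree t ht p hp1.le hp2⟩, ?_⟩
  · -- the off-window piece
    refine ⟨ρ, hρ, fun ε hε η hη => ?_⟩
    obtain ⟨m, hm⟩ := hconv' η hη
    refine ⟨m, fun n hn t ht p hp1 hp2 => ?_⟩
    rw [← hagree t ht p (by linarith) hp2]
    exact hm n hn t ht p (by linarith) hp2
  · -- window flatness
    intro η hη
    have hη3 : 0 < η / 3 := by positivity
    have hL1 : 0 < |L| + 1 := by positivity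
    set ε : ℝ := min ρ (η / (3 * (|L| + 1))) with hεdef
    have hε : 0 < ε := lt_min hρ (by positivity)
    have hερ : ε ≤ ρ := min_le_left _ _
    have hεL : ε ≤ η / (3 * (|L| + 1)) := min_le_right _ _
    obtain ⟨m, hm⟩ := hconv' (η / 3) hη3
    refine ⟨ε, hε, max 1 m, fun n hn t ht p p' hp1 hp2 hq1 hq2 => ?_⟩
    have hn₀ : 1 ≤ n := le_trans (le_max_left _ _) hn
    have hn₁ : m ≤ n := le_trans (le_max_right _ _) hn
    have hDp : 0 < D n p t := hpos' n hn₀ t ht p hp1 (by linarith)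
    have hDq : 0 < D n p' t := hpos' n hn₀ t ht p' hq1 (by linarith)
    have hrp : |N n p t / D n p t - a p t| ≤ η / 3 := by
      have e : N n p t / D n p t - a p t = (N n p t - a p t * D n p t) / D n p t := by
        field_simp
      rw [e, abs_div, abs_of_pos hDp, div_le_iff₀ hDp]
      exact hm n hn₁ t ht p hp1 (by linarith)
    have hrq : |N n p' t / D n p' t - a p' t| ≤ η / 3 := by
      have e : N n p' t / D n p' t - a p' t = (N n p' t - a p' t * D n p' t) / D n p' t := by
        field_simp
      rw [e, abs_div, abs_of_pos hDq, div_le_iff₀ hDq]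
      exact hm n hn₁ t ht p' hq1 (by linarith)
    have hl := hlip' t ht p p' hp1 (by linarith) hq1 (by linarith)
    have hpp' : |p - p'| ≤ ε := by
      rw [abs_le]; constructor <;> linarith
    have hl' : |a p t - a p' t| ≤ η / 3 :=
      calc |a p t - a p' t| ≤ L * |p - p'| := hl
        _ ≤ |L| * |p - p'| := mul_le_mul_of_nonneg_right (le_abs_self L) (abs_nonneg _)
        _ ≤ |L| * ε := mul_le_mul_of_nonneg_left hpp' (abs_nonneg L)
        _ ≤ |L| * (η / (3 * (|L| + 1))) := mul_le_mul_of_nonneg_left hεL (abs_nonneg L)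
        _ ≤ η / 3 := by
          rw [← sub_nonneg]
          have e : η / 3 - |L| * (η / (3 * (|L| + 1))) = (η / 3) * (1 / (|L| + 1)) := by
            field_simp
            ring
          rw [e]
          positivity
    calc |N n p t / D n p t - N n p' t / D n p' t|
        ≤ |N n p t / D n p t - a p t| + |a p t - a p' t| + |a p' t - N n p' t / D n p' t| := by
          have := abs_sub_le (N n p t / D n p t) (a p t) (N n p' t / D n p' t)
          have := abs_sub_le (a p t) (a p' t) (N n p' t / D n p' t)
          linarith
      _ ≤ η / 3 + η / 3 + η / 3 := by rw [abs_sub_comm (a p' t)]; gcongr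
      _ = η := by ring

end Split

open Split

/-! ## The anchor theorems: the registered pieces, verbatim, and the crux BY NAME -/

/-- **K⁺ from the three open pieces** (regime-split glue; hypotheses = the registered stubs
`OffWindowLimit`, `LimitFieldRegular`, `WindowFlatness` of stmt-CriticalPhenomena-16061, verbatim;
conclusion = the route declaration `PercExchangeRateTransport.SupercritExchangeUniformity` by name;
the fourth piece of the split, Russo positivity `0 < ∂_pΘ_n` on a collar for `n ≥ 1`, is discharged
by `Split.deriv_p_pos_collar` = the landed `RussoPositivity`, p172277).  On `[lo,hi]`:
`Split.crux_of_pieces` with `N := ∂_tΘ`, `D := ∂_pΘ`, the route's `pc`,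
`aInf := limUnder_n (∂_tΘ_n/∂_pΘ_n)`. [folklore] -/
theorem SupercritExchangeUniformity_of_subs : (let μ := Literature.Probability.Percolation.labelMeasure (Literature.Probability.LatticeModels.Site 3); let vert : Sym2 (Literature.Probability.LatticeModels.Site 3) → Prop := fun e => ∃ x : Literature.Probability.LatticeModels.Site 3, e = s(x, x + Pi.single (2 : Fin 3) 1); let cfg : ℝ → ℝ → (Sym2 (Literature.Probability.LatticeModels.Site 3) → ℝ) → Set (Sym2 (Literature.Probability.LatticeModels.Site 3)) := fun p t U => {e | e ∈ (Literature.Probability.LatticeModels.zdGraph 3).edgeSet ∧ ((vert e ∧ U e ≤ t) ∨ (¬ vert e ∧ U e ≤ p))}; let Θ : ℕ → ℝ → ℝ → ℝ := fun n p t => μ.real {U | cfg p t U ∈ Literature.Probability.Percolation.siteToBoundary 3 n}; let θ : ℝ → ℝ → ℝ := fun p t => μ.real {U | cfg p t U ∈ Literature.Probability.Percolation.percolatesAt (0 : Literature.Probability.LatticeModels.Site 3)}; let pc : ℝ → ℝ := fun t => sInf ({p : ℝ | 0 ≤ p ∧ p ≤ 1 ∧ 0 < θ p t} ∪ {1}); let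 aInf : ℝ → ℝ → ℝ := fun p t => limUnder Filter.atTop (fun n : ℕ => deriv (fun s => Θ n p s) t / deriv (fun q => Θ n q t) p); ∀ lo hi : ℝ, 0 < lo → lo < hi → hi < 1 → ∃ ρ > (0 : ℝ), ∀ ε > (0 : ℝ), ∀ η > (0 : ℝ), ∃ m : ℕ, ∀ n ≥ m, ∀ t ∈ Set.Icc lo hi, ∀ p : ℝ, pc t + ε ≤ p → p ≤ pc t + ρ → |deriv (fun s => Θ n p s) t - aInf p t * deriv (fun q => Θ n q t) p| ≤ η * deriv (fun q => Θ n q t) p) → (let μ := Literature.Probability.Percolation.labelMeasure (Literature.Probability.LatticeModels.Site 3); let vert : Sym2 (Literature.Probability.LatticeModels.Site 3) → Prop := fun e => ∃ x : Literature.Probability.LatticeModels.Site 3, e = s(x, x + Pi.single (2 : Fin 3) 1); let cfg : ℝ → ℝ → (Sym2 (Literature.Probability.LatticeModels.Site 3) → ℝ) → Set (Sym2 (Literature.Probability.LatticeModels.Site 3)) := fun p t U => {e | e ∈ (Literature.Probability.LatticeModels.zdGraph 3).edgeSet ∧ ((vert e ∧ U e ≤ t) ∨ (¬ vert e ∧ U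 e ≤ p))}; let Θ : ℕ → ℝ → ℝ → ℝ := fun n p t => μ.real {U | cfg p t U ∈ Literature.Probability.Percolation.siteToBoundary 3 n}; let θ : ℝ → ℝ → ℝ := fun p t => μ.real {U | cfg p t U ∈ Literature.Probability.Percolation.percolatesAt (0 : Literature.Probability.LatticeModels.Site 3)}; let pc : ℝ → ℝ := fun t => sInf ({p : ℝ | 0 ≤ p ∧ p ≤ 1 ∧ 0 < θ p t} ∪ {1}); let aInf : ℝ → ℝ → ℝ := fun p t => limUnder Filter.atTop (fun n : ℕ => deriv (fun s => Θ n p s) t / deriv (fun q => Θ n q t) p); ∀ lo hi : ℝ, 0 < lo → lo < hi → hi < 1 → ∃ ρ > (0 : ℝ), ∃ L : ℝ, ∃ a : ℝ → ℝ → ℝ, ContinuousOn (fun x : ℝ × ℝ => a x.1 x.2) {x : ℝ × ℝ | x.2 ∈ Set.Icc lo hi ∧ pc x.2 ≤ x.1 ∧ x.1 ≤ pc x.2 + ρ} ∧ (∀ t ∈ Set.Icc lo hi, ∀ p q : ℝ, pc t ≤ p → p ≤ pc t + ρ → pc t ≤ q → q ≤ pc t + ρ → |a p t - a q t| ≤ L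 * |p - q|) ∧ ∀ t ∈ Set.Icc lo hi, ∀ p : ℝ, pc t < p → p ≤ pc t + ρ → a p t = aInf p t) → (let μ := Literature.Probability.Percolation.labelMeasure (Literature.Probability.LatticeModels.Site 3); let vert : Sym2 (Literature.Probability.LatticeModels.Site 3) → Prop := fun e => ∃ x : Literature.Probability.LatticeModels.Site 3, e = s(x, x + Pi.single (2 : Fin 3) 1); let cfg : ℝ → ℝ → (Sym2 (Literature.Probability.LatticeModels.Site 3) → ℝ) → Set (Sym2 (Literature.Probability.LatticeModels.Site 3)) := fun p t U => {e | e ∈ (Literature.Probability.LatticeModels.zdGraph 3).edgeSet ∧ ((vert e ∧ U e ≤ t) ∨ (¬ vert e ∧ U e ≤ p))}; let Θ : ℕ → ℝ → ℝ → ℝ := fun n p t => μ.real {U | cfg p t U ∈ Literature.Probability.Percolation.siteToBoundary 3 n}; let θ : ℝ → ℝ → ℝ := fun p t => μ.real {U | cfg p t U ∈ Literature.Probability.Percolation.percolatesAt (0 : Literature.Probability.LatticeModels.Site 3)}; let pc : ℝ → ℝ := fun t => sInf ({p : ℝ | 0 ≤ p ∧ p ≤ 1 ∧ 0 < θ p t}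 ∪ {1}); ∀ lo hi : ℝ, 0 < lo → lo < hi → hi < 1 → ∀ η > (0 : ℝ), ∃ ε > (0 : ℝ), ∃ m : ℕ, ∀ n ≥ m, ∀ t ∈ Set.Icc lo hi, ∀ p p' : ℝ, pc t ≤ p → p ≤ pc t + ε → pc t ≤ p' → p' ≤ pc t + ε → |deriv (fun s => Θ n p s) t / deriv (fun q => Θ n q t) p - deriv (fun s => Θ n p' s) t / deriv (fun q => Θ n q t) p'| ≤ η) → Summit.CriticalPhenomena.PercolationContinuityZ3.Theses.PercExchangeRateTransport.SupercritExchangeUniformity := by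
  intro hOff hReg hFlat
  obtain ⟨ε₀, hε₀, hpos⟩ := deriv_p_pos_collar
  delta Summit.CriticalPhenomena.PercolationContinuityZ3.Theses.PercExchangeRateTransport.SupercritExchangeUniformity
  intro μ vert cfg Θ θ pc lo hi hlo hlh hhi
  exact crux_of_pieces (N := fun n p t => deriv (fun s => Θ n p s) t)
    (D := fun n p t => deriv (fun q => Θ n q t) p) (pc := pc)
    (aInf := fun p t => limUnder Filter.atTop
      (fun n : ℕ => deriv (fun s => Θ n p s) t / deriv (fun q => Θ n q t) p))
    (hOff lo hi hlo hlh hhi) (hReg lo hi hlo hlh hhi) (hFlat lo hi hlo hlh hhi)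
    ⟨ε₀, hε₀, fun n hn t ht p h1 h2 => hpos n hn t ⟨hlo.trans_le ht.1, ht.2.trans_lt hhi⟩ p h1 h2⟩

/-- **The three open pieces from K⁺** (the split is LOSSLESS: hypothesis = the route declaration
`PercExchangeRateTransport.SupercritExchangeUniformity` by name; conclusion = the conjunction of the
registered stubs `OffWindowLimit`, `LimitFieldRegular`, `WindowFlatness`, verbatim; positivity again
from `Split.deriv_p_pos_collar`).  On each `[lo,hi]`: `Split.pieces_of_crux` with `N := ∂_tΘ`,
`D := ∂_pΘ` and the route's `pc` (collar `min ρ ε₀`, `a = a_∞` there by pointwise convergence,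
flatness by `η/3 + η/3 + L·ε`). [folklore] -/
theorem subs_of_SupercritExchangeUniformity : Summit.CriticalPhenomena.PercolationContinuityZ3.Theses.PercExchangeRateTransport.SupercritExchangeUniformity → (let μ := Literature.Probability.Percolation.labelMeasure (Literature.Probability.LatticeModels.Site 3); let vert : Sym2 (Literature.Probability.LatticeModels.Site 3) → Prop := fun e => ∃ x : Literature.Probability.LatticeModels.Site 3, e = s(x, x + Pi.single (2 : Fin 3) 1); let cfg : ℝ → ℝ → (Sym2 (Literature.Probability.LatticeModels.Site 3) → ℝ) → Set (Sym2 (Literature.Probability.LatticeModels.Site 3)) := fun p t U => {e | e ∈ (Literature.Probability.LatticeModels.zdGraph 3).edgeSet ∧ ((vert e ∧ U e ≤ t) ∨ (¬ vert e ∧ U e ≤ p))}; let Θ : ℕ → ℝ → ℝ → ℝ := fun n p t => μ.real {U | cfg p t U ∈ Literature.Probability.Percolation.siteToBoundary 3 n}; let θ : ℝ → ℝ → ℝ := fun p t => μ.real {U | cfg p t U ∈ Literature.Probability.Percolation.percolatesAt (0 : Literature.Probability.LatticeModels.Site 3)}; let pc : ℝ → ℝ := fun t => sInf ({p : ℝ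 | 0 ≤ p ∧ p ≤ 1 ∧ 0 < θ p t} ∪ {1}); let aInf : ℝ → ℝ → ℝ := fun p t => limUnder Filter.atTop (fun n : ℕ => deriv (fun s => Θ n p s) t / deriv (fun q => Θ n q t) p); ∀ lo hi : ℝ, 0 < lo → lo < hi → hi < 1 → ∃ ρ > (0 : ℝ), ∀ ε > (0 : ℝ), ∀ η > (0 : ℝ), ∃ m : ℕ, ∀ n ≥ m, ∀ t ∈ Set.Icc lo hi, ∀ p : ℝ, pc t + ε ≤ p → p ≤ pc t + ρ → |deriv (fun s => Θ n p s) t - aInf p t * deriv (fun q => Θ n q t) p| ≤ η * deriv (fun q => Θ n q t) p) ∧ (let μ := Literature.Probability.Percolation.labelMeasure (Literature.Probability.LatticeModels.Site 3); let vert : Sym2 (Literature.Probability.LatticeModels.Site 3) → Prop := fun e => ∃ x : Literature.Probability.LatticeModels.Site 3, e = s(x, x + Pi.single (2 : Fin 3) 1); let cfg : ℝ → ℝ → (Sym2 (Literature.Probability.LatticeModels.Site 3) → ℝ) → Set (Sym2 (Literature.Probability.LatticeModels.Site 3)) := fun p t U => {e | e ∈ (Literature.Probability.LatticeModels.zdGraph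 3).edgeSet ∧ ((vert e ∧ U e ≤ t) ∨ (¬ vert e ∧ U e ≤ p))}; let Θ : ℕ → ℝ → ℝ → ℝ := fun n p t => μ.real {U | cfg p t U ∈ Literature.Probability.Percolation.siteToBoundary 3 n}; let θ : ℝ → ℝ → ℝ := fun p t => μ.real {U | cfg p t U ∈ Literature.Probability.Percolation.percolatesAt (0 : Literature.Probability.LatticeModels.Site 3)}; let pc : ℝ → ℝ := fun t => sInf ({p : ℝ | 0 ≤ p ∧ p ≤ 1 ∧ 0 < θ p t} ∪ {1}); let aInf : ℝ → ℝ → ℝ := fun p t => limUnder Filter.atTop (fun n : ℕ => deriv (fun s => Θ n p s) t / deriv (fun q => Θ n q t) p); ∀ lo hi : ℝ, 0 < lo → lo < hi → hi < 1 → ∃ ρ > (0 : ℝ), ∃ L : ℝ, ∃ a : ℝ → ℝ → ℝ, ContinuousOn (fun x : ℝ × ℝ => a x.1 x.2) {x : ℝ × ℝ | x.2 ∈ Set.Icc lo hi ∧ pc x.2 ≤ x.1 ∧ x.1 ≤ pc x.2 + ρ} ∧ (∀ t ∈ Set.Icc lo hi, ∀ p q : ℝ, pc t ≤ p → p ≤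 pc t + ρ → pc t ≤ q → q ≤ pc t + ρ → |a p t - a q t| ≤ L * |p - q|) ∧ ∀ t ∈ Set.Icc lo hi, ∀ p : ℝ, pc t < p → p ≤ pc t + ρ → a p t = aInf p t) ∧ (let μ := Literature.Probability.Percolation.labelMeasure (Literature.Probability.LatticeModels.Site 3); let vert : Sym2 (Literature.Probability.LatticeModels.Site 3) → Prop := fun e => ∃ x : Literature.Probability.LatticeModels.Site 3, e = s(x, x + Pi.single (2 : Fin 3) 1); let cfg : ℝ → ℝ → (Sym2 (Literature.Probability.LatticeModels.Site 3) → ℝ) → Set (Sym2 (Literature.Probability.LatticeModels.Site 3)) := fun p t U => {e | e ∈ (Literature.Probability.LatticeModels.zdGraph 3).edgeSet ∧ ((vert e ∧ U e ≤ t) ∨ (¬ vert e ∧ U e ≤ p))}; let Θ : ℕ → ℝ → ℝ → ℝ := fun n p t => μ.real {U | cfg p t U ∈ Literature.Probability.Percolation.siteToBoundary 3 n}; let θ : ℝ → ℝ → ℝ := fun p t => μ.real {U | cfg p t U ∈ Literature.Probability.Percolation.percolatesAt (0 : Literature.Probability.LatticeModels.Site 3)}; let pc : ℝ → ℝ :=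 fun t => sInf ({p : ℝ | 0 ≤ p ∧ p ≤ 1 ∧ 0 < θ p t} ∪ {1}); ∀ lo hi : ℝ, 0 < lo → lo < hi → hi < 1 → ∀ η > (0 : ℝ), ∃ ε > (0 : ℝ), ∃ m : ℕ, ∀ n ≥ m, ∀ t ∈ Set.Icc lo hi, ∀ p p' : ℝ, pc t ≤ p → p ≤ pc t + ε → pc t ≤ p' → p' ≤ pc t + ε → |deriv (fun s => Θ n p s) t / deriv (fun q => Θ n q t) p - deriv (fun s => Θ n p' s) t / deriv (fun q => Θ n q t) p'| ≤ η) := by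
  intro hK
  obtain ⟨ε₀, hε₀, hpos⟩ := deriv_p_pos_collar
  refine ⟨?_, ?_, ?_⟩
  · intro μ vert cfg Θ θ pc aInf lo hi hlo hlh hhi
    exact (pieces_of_crux (N := fun n p t => deriv (fun s => Θ n p s) t)
      (D := fun n p t => deriv (fun q => Θ n q t) p) (pc := pc) (hK lo hi hlo hlh hhi)
      ⟨ε₀, hε₀, fun n hn t ht p hp1 hp2 =>
        hpos n hn t ⟨hlo.trans_le ht.1, ht.2.trans_lt hhi⟩ p hp1 hp2⟩).1
  · intro μ vert cfg Θ θ pc aInf lo hi hlo hlh hhi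
    exact (pieces_of_crux (N := fun n p t => deriv (fun s => Θ n p s) t)
      (D := fun n p t => deriv (fun q => Θ n q t) p) (pc := pc) (hK lo hi hlo hlh hhi)
      ⟨ε₀, hε₀, fun n hn t ht p hp1 hp2 =>
        hpos n hn t ⟨hlo.trans_le ht.1, ht.2.trans_lt hhi⟩ p hp1 hp2⟩).2.1
  · intro μ vert cfg Θ θ pc lo hi hlo hlh hhi
    exact (pieces_of_crux (N := fun n p t => deriv (fun s => Θ n p s) t)
      (D := fun n p t => deriv (fun q => Θ n q t) p) (pc := pc) (hK lo hi hlo hlh hhi)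
      ⟨ε₀, hε₀, fun n hn t ht p hp1 hp2 =>
        hpos n hn t ⟨hlo.trans_le ht.1, ht.2.trans_lt hhi⟩ p hp1 hp2⟩).2.2

end Summit.CriticalPhenomena.PercolationContinuityZ3.Theorems.SupercritExchangeUniformity

end
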